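import Literature.NumberTheory.Automorphic.WhittakerTower
import Literature.NumberTheory.Automorphic.ColumnGroupFourier
import Literature.NumberTheory.Automorphic.UnipotentColumnSplit
import HarnessLib

/-!
# The Whittaker tower, II: `(U, ψ)`-equivariance of the partial Whittaker transforms

Topic `NumberTheory/Automorphic`; namespace `Literature.NumberTheory.Automorphic`. Sequel to
`WhittakerTower`. For `φ : GL_n(𝔸_K) → ℂ` left `GL_n(K)`-invariant, the partial Whittaker transform
`Φ = whittakerIter k φ` (the columns `n-1, …, c = n-k` integrated against `ψ`) satisfies

  `Φ(u g) = ψ_{≥c}(u) Φ(g)`,  `u ∈ U_{[c, n-1]}(𝔸_K)`,  `ψ_{≥c}(u) = ψ(Σ_{j ≥ c} u_{j-1,j})`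

(`whittakerIter_colRange_mul`; Cogdell (2004), §1.1: `W_φ(n g) = ψ(n) W_φ(g)` is the case `c = 1`).
The induction step `c + 1 → c` (`colTransform_colRange_mul`): write `u = h y₀` with
`h ∈ U_{[c+1,n-1]}`, `y₀ ∈ Y_c` (`UnipotentColumnSplit`); for `y ∈ Y_c(𝔸_K)`,
`y h = (y h y⁻¹) y` with `y h y⁻¹ ∈ U_{[c+1,n-1]}` having the same superdiagonal as `h`, so the
inductive equivariance pulls out `ψ_{≥c+1}(h)`; then `y y₀ = y₀ y` (`Y_c` is commutative) and the
translate `y₀ · box` of the Tate box is again a fundamental domain of `Y_c(K)`, over which the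
`Y_c(K)`-invariant integrand has the same integral, which pulls out `ψ(y₀{}_{c-1,c})`. Also:
`superdiagSumFrom`, `unipotentCharFrom` and their algebra, `colGroup_mul_comm`,
`setIntegral_box_mul_right_eq` (translation invariance of box integrals of invariant functions), and
the **coefficient identity** `whittakerDepth_pred_lowCorner_mul`: for `B ∈ GL_d(K)` with low row `η`
and `s = diag(B, 1)`, `Φ_{d-1}(s g) = μ(box)⁻¹ ∫_{box} conj ψ_η(y) Φ_d(y g) dy` — the Fourier
coefficients of `y ↦ Φ_d(y g)` along `Y_d(K) \ Y_d(𝔸_K)` are values of `Φ_{d-1}` (the identity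
`c_η(g) = W(γ_η g)` in the proof of Cogdell's Thm. 1.1), via `corner_conj_apply_pred`.
Everything is proved.

## References

* J. W. Cogdell, *Analytic theory of L-functions for GL_n*, in *An Introduction to the Langlands
  Program* (2004), §1.1 [CogdellAnalyticTheory2004].
* H. Jacquet, J. A. Shalika, *On Euler products and the classification of automorphic
  representations I*, Amer. J. Math. 103 (1981), §4 [JacquetShalikaAJM1981].
-/

noncomputable section

open MeasureTheory Measure NumberField IsDedekindDomain Matrix Set Filter Topology
open scoped MatrixGroups ENNReal NNReal ComplexConjugate

namespace Literature.NumberTheory.Automorphic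

/-! ### The superdiagonal sums and the characters `ψ_{≥c}` -/

section Superdiag

variable {n : ℕ} {R : Type*} [CommRing R]

/-- **The superdiagonal sum from the column `c` on**: `Σ_{j ≥ c, j ≥ 1} M_{j-1,j}`. [folklore] -/
def superdiagSumFrom (c : ℕ) (M : Matrix (Fin n) (Fin n) R) : R :=
  ∑ j : Fin n, if h : c ≤ (j : ℕ) ∧ 0 < (j : ℕ) then M ⟨(j : ℕ) - 1, by have := j.2; omega⟩ j else 0

/-- Splitting off the first term: `Σ_{j ≥ c} = Σ_{j ≥ c+1} + M_{c-1,c}` (`1 ≤ c < n`). [folklore] -/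
theorem superdiagSumFrom_eq_succ_add {c : ℕ} (hc : c < n) (hc0 : 0 < c) (M : Matrix (Fin n) (Fin n) R) :
    superdiagSumFrom c M = superdiagSumFrom (c + 1) M + M ⟨c - 1, by omega⟩ ⟨c, hc⟩ := by
  classical
  unfold superdiagSumFrom
  rw [← Finset.add_sum_erase _ _ (Finset.mem_univ (⟨c, hc⟩ : Fin n)),
    ← Finset.add_sum_erase _ (fun j : Fin n => if h : c + 1 ≤ (j : ℕ) ∧ 0 < (j : ℕ) then
        M ⟨(j : ℕ) - 1, by have := j.2; omega⟩ j else 0) (Finset.mem_univ (⟨c, hc⟩ : Fin n))]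
  have h1 : (if h : c ≤ ((⟨c, hc⟩ : Fin n) : ℕ) ∧ 0 < ((⟨c, hc⟩ : Fin n) : ℕ) then
      M ⟨((⟨c, hc⟩ : Fin n) : ℕ) - 1, by simp; omega⟩ ⟨c, hc⟩ else 0) = M ⟨c - 1, by omega⟩ ⟨c, hc⟩ := by
    rw [dif_pos ⟨le_rfl, hc0⟩]
  have h2 : (if h : c + 1 ≤ ((⟨c, hc⟩ : Fin n) : ℕ) ∧ 0 < ((⟨c, hc⟩ : Fin n) : ℕ) then
      M ⟨((⟨c, hc⟩ : Fin n) : ℕ) - 1, by simp; omega⟩ ⟨c, hc⟩ else 0) = 0 := by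
    rw [dif_neg]; simp
  rw [h1, h2, zero_add, add_comm]
  congr 1
  refine Finset.sum_congr rfl fun j hj => ?_
  have hjc : (j : ℕ) ≠ c := by
    intro h
    have : j = ⟨c, hc⟩ := Fin.ext h
    rw [Finset.mem_erase] at hj
    exact hj.1 this
  by_cases h : c ≤ (j : ℕ) ∧ 0 < (j : ℕ)
  · rw [dif_pos h, dif_pos ⟨by omega, h.2⟩]
  · rw [dif_neg h, dif_neg (fun h' => h ⟨by omega, h'.2⟩)]

/-- Rows `≥ c` of an element of the column group `Y_c` are unit rows. [folklore] -/
theorem colGroup_apply_of_le {c : ℕ} {y : GL (Fin n) R} (hy : y ∈ unipotentColRange n R c c) {i : Fin n}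
    (hi : c ≤ (i : ℕ)) (a : Fin n) : (y : Matrix (Fin n) (Fin n) R) i a = if i = a then 1 else 0 := by
  by_cases hai : a ≤ i
  · exact apply_of_le hy hai
  · exact apply_of_not_inColRange hy i fun h => by
      have := Fin.lt_def.1 (lt_of_not_ge hai); have h2 := h.2; omega

/-- `(y M)_{ij} = M_{ij}` for `i ≥ c` and `y ∈ Y_c`. [folklore] -/
theorem colGroup_mul_apply_of_le {c : ℕ} {y : GL (Fin n) R} (hy : y ∈ unipotentColRange n R c c)
    {i : Fin n} (hi : c ≤ (i : ℕ)) (M : Matrix (Fin n) (Fin n) R) (j : Fin n) :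
    ((y : Matrix (Fin n) (Fin n) R) * M) i j = M i j := by
  rw [Matrix.mul_apply]
  simp only [colGroup_apply_of_le hy hi, ite_mul, one_mul, zero_mul, Finset.sum_ite_eq,
    Finset.mem_univ, if_true]

/-- **(E1)** Left multiplication by `y ∈ Y_c` does not change the superdiagonal from `c + 1` on.
[folklore] -/
theorem superdiagSumFrom_succ_colGroup_mul {c : ℕ} {y : GL (Fin n) R} (hy : y ∈ unipotentColRange n R c c)
    (M : Matrix (Fin n) (Fin n) R) :
    superdiagSumFrom (c + 1) ((y : Matrix (Fin n) (Fin n) R) * M) = superdiagSumFrom (c + 1) M := by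
  unfold superdiagSumFrom
  refine Finset.sum_congr rfl fun j _ => ?_
  by_cases h : c + 1 ≤ (j : ℕ) ∧ 0 < (j : ℕ)
  · rw [dif_pos h, dif_pos h, colGroup_mul_apply_of_le hy (by simp; omega)]
  · rw [dif_neg h, dif_neg h]

/-- **(E2)** The superdiagonal from `c + 1` on of `h ℓ`, `h ∈ U_{[c+1,b]}`, `ℓ ∈ U_{[a,c]}`, is that of
`h` (entries are copied, `mul_apply_of_colRange`). [folklore] -/
theorem superdiagSumFrom_succ_high_mul_low {c a b : ℕ} {h ℓ : GL (Fin n) R}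
    (hh : h ∈ unipotentColRange n R (c + 1) b) (hℓ : ℓ ∈ unipotentColRange n R a c) :
    superdiagSumFrom (c + 1) ((h * ℓ : GL (Fin n) R) : Matrix (Fin n) (Fin n) R) =
      superdiagSumFrom (c + 1) (h : Matrix (Fin n) (Fin n) R) := by
  unfold superdiagSumFrom
  refine Finset.sum_congr rfl fun j _ => ?_
  by_cases hj : c + 1 ≤ (j : ℕ) ∧ 0 < (j : ℕ)
  · rw [dif_pos hj, dif_pos hj, mul_apply_of_colRange c hh hℓ, if_neg (by omega)]
  · rw [dif_neg hj, dif_neg hj]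

/-- **(E4)** For `u = h ℓ` as above and `1 ≤ c < n`:
`Σ_{j ≥ c} u_{j-1,j} = Σ_{j ≥ c+1} h_{j-1,j} + ℓ_{c-1,c}`. [folklore] -/
theorem superdiagSumFrom_high_mul_low {c a b : ℕ} (hc : c < n) (hc0 : 0 < c) {h ℓ : GL (Fin n) R}
    (hh : h ∈ unipotentColRange n R (c + 1) b) (hℓ : ℓ ∈ unipotentColRange n R a c) :
    superdiagSumFrom c ((h * ℓ : GL (Fin n) R) : Matrix (Fin n) (Fin n) R) =
      superdiagSumFrom (c + 1) (h : Matrix (Fin n) (Fin n) R) + (ℓ : Matrix (Fin n) (Fin n) R) ⟨c - 1, by omega⟩ ⟨c, hc⟩ := by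
  rw [superdiagSumFrom_eq_succ_add hc hc0, superdiagSumFrom_succ_high_mul_low hh hℓ, mul_apply_of_colRange c hh hℓ,
    if_pos (by simp)]

end Superdiag

section Equivariance

variable {n : ℕ} {K : Type} [Field K] [NumberField K]
variable [MeasurableSpace (GL (Fin n) (AdeleRing (𝓞 K) K))] [BorelSpace (GL (Fin n) (AdeleRing (𝓞 K) K))]

/-- **The character `ψ_{≥c}` of `N_n(𝔸_K)`**: `u ↦ ψ(Σ_{j ≥ c} u_{j-1,j})` (for `c = 1` the generic
character `ψ_N` of the Whittaker model). [folklore] -/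
def unipotentCharFrom (c : ℕ) (u : GL (Fin n) (AdeleRing (𝓞 K) K)) : Circle :=
  adeleAddChar K (superdiagSumFrom c ((u : GL (Fin n) (AdeleRing (𝓞 K) K)) : Matrix (Fin n) (Fin n) (AdeleRing (𝓞 K) K)))

omit [MeasurableSpace (GL (Fin n) (AdeleRing (𝓞 K) K))] [BorelSpace (GL (Fin n) (AdeleRing (𝓞 K) K))] in
/-- `ψ_{≥c}(u)` unfolded. [folklore] -/
theorem unipotentCharFrom_apply (c : ℕ) (u : GL (Fin n) (AdeleRing (𝓞 K) K)) :
    unipotentCharFrom (K := K) c u = adeleAddChar K (superdiagSumFrom c (u : Matrix (Fin n) (Fin n) (AdeleRing (𝓞 K) K))) :=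
  rfl

omit [MeasurableSpace (GL (Fin n) (AdeleRing (𝓞 K) K))] [BorelSpace (GL (Fin n) (AdeleRing (𝓞 K) K))] in
/-- **`Y_c(𝔸_K)` is commutative** (it is `𝔾_a^c`: `colVecY_add`). [folklore] -/
theorem colGroup_mul_comm {c : ℕ} (hc : c < n) (y y' : ↥(adelicColRange n K c c)) : y * y' = y' * y := by
  obtain ⟨x, rfl⟩ := (colVecHomeomorph (n := n) (K := K) c hc).surjective y
  obtain ⟨x', rfl⟩ := (colVecHomeomorph (n := n) (K := K) c hc).surjective y'
  simp only [colVecHomeomorph_apply]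
  rw [← colVecY_add c hc, ← colVecY_add c hc, add_comm]

/-- **Translation invariance of box integrals of invariant functions**: for `G` on `Y_c(𝔸_K)`
invariant under left multiplication by `Y_c(K)` and `y₀ ∈ Y_c(𝔸_K)`,
`∫_{box} G(y y₀) dμ = ∫_{box} G dμ` (`y y₀ = y₀ y`; the translate `y₀ · box` is again a fundamental
domain because the translation commutes with the lattice action). [folklore] -/
theorem setIntegral_box_mul_right_eq {c : ℕ} (hc : c < n) (μ : Measure ↥(adelicColRange n K c c))
    [IsHaarMeasure μ] {E : Type*} [NormedAddCommGroup E] [NormedSpace ℝ E]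
    {G : ↥(adelicColRange n K c c) → E}
    (hG : ∀ (γ : ↥(rationalColRange n K c c)) (y : ↥(adelicColRange n K c c)), G (γ • y) = G y)
    (y₀ : ↥(adelicColRange n K c c)) :
    ∫ y in colRangeTateDomain n K c c, G (y * y₀) ∂μ = ∫ y in colRangeTateDomain n K c c, G y ∂μ := by
  have hcomm : ∀ y : ↥(adelicColRange n K c c), y * y₀ = y₀ * y := fun y => colGroup_mul_comm hc y y₀
  simp_rw [hcomm]
  -- `∫_{box} G(y₀ y) = ∫_{y₀ box} G`
  have hmp : MeasurePreserving (fun y : ↥(adelicColRange n K c c) => y₀ * y) μ μ :=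
    measurePreserving_mul_left μ y₀
  have hme : MeasurableEmbedding (fun y : ↥(adelicColRange n K c c) => y₀ * y) :=
    (MeasurableEquiv.mulLeft y₀).measurableEmbedding
  rw [← hmp.setIntegral_image_emb hme]
  -- `y₀ box` is a fundamental domain
  have hfd : IsFundamentalDomain ↥(rationalColRange n K c c)
      ((fun y : ↥(adelicColRange n K c c) => y₀ * y) '' colRangeTateDomain n K c c) μ := by
    have h𝓕 := isFundamentalDomain_colRangeTateDomain (n := n) (K := K) (a := c) (b := c) μ
    have hq : QuasiMeasurePreserving ((Equiv.mulLeft y₀).symm : ↥(adelicColRange n K c c) → _) μ μ := by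
      have : ((Equiv.mulLeft y₀).symm : ↥(adelicColRange n K c c) → ↥(adelicColRange n K c c)) =
          fun y => y₀⁻¹ * y := by
        funext y; simp [Equiv.mulLeft_symm]
      rw [this]
      exact (measurePreserving_mul_left μ y₀⁻¹).quasiMeasurePreserving
    have h := h𝓕.image_of_equiv (Equiv.mulLeft y₀) hq (Equiv.refl _) fun γ y => ?_
    · exact h
    · change y₀ * ((γ : ↥(adelicColRange n K c c)) * y) = (γ : ↥(adelicColRange n K c c)) * (y₀ * y)
      rw [← mul_assoc, ← mul_assoc, colGroup_mul_comm hc y₀]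
  exact hfd.setIntegral_eq (isFundamentalDomain_colRangeTateDomain μ) hG

/-- **One step of the equivariance.** Let `1 ≤ c < n`, `Φ` continuous, left-invariant under the rational
points of `Q_c ⊓ GL_{c+1}` (in particular under `Y_c(K)`) and `(U_{[c+1,n-1]}(𝔸_K), ψ_{≥c+1})`-equivariant.
Then `T_c Φ (u g) = ψ_{≥c}(u) T_c Φ(g)` for `u ∈ U_{[c,n-1]}(𝔸_K)`. [folklore] -/
theorem colTransform_colRange_mul (c : ℕ) (hc : c < n) (hc0 : 0 < c)
    {Φ : GL (Fin n) (AdeleRing (𝓞 K) K) → ℂ}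
    (hΦK : ∀ q₀ : GL (Fin n) K, q₀ ∈ tailUnipotent n K c → q₀ ∈ cornerGL n K (c + 1) →
      ∀ x, Φ (Matrix.GeneralLinearGroup.map (algebraMap K (AdeleRing (𝓞 K) K)) q₀ * x) = Φ x)
    (hΦU : ∀ h : GL (Fin n) (AdeleRing (𝓞 K) K), h ∈ adelicColRange n K (c + 1) (n - 1) →
      ∀ x, Φ (h * x) = (unipotentCharFrom (K := K) (c + 1) h : ℂ) * Φ x)
    {u : GL (Fin n) (AdeleRing (𝓞 K) K)} (hu : u ∈ adelicColRange n K c (n - 1))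
    (g : GL (Fin n) (AdeleRing (𝓞 K) K)) :
    colTransform c hc hc0 Φ (u * g) = (unipotentCharFrom (K := K) c u : ℂ) * colTransform c hc hc0 Φ g := by
  -- split `u = h y₀`
  set h := colSplitHigh c u with hh_def
  set y₀ := colSplitLow c u with hy₀_def
  have hh : h ∈ adelicColRange n K (c + 1) (n - 1) := colSplitHigh_mem c hu
  have hy₀ : y₀ ∈ adelicColRange n K c c := colSplitLow_mem c hu
  have hu' : h * y₀ = u := colSplit_mul c hu
  set Y₀ : ↥(adelicColRange n K c c) := ⟨y₀, hy₀⟩ with hY₀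
  -- the character of `u`
  have hchar : (unipotentCharFrom (K := K) c u : ℂ) =
      (unipotentCharFrom (K := K) (c + 1) h : ℂ) *
        (adeleAddChar K ((y₀ : Matrix (Fin n) (Fin n) (AdeleRing (𝓞 K) K)) ⟨c - 1, by omega⟩ ⟨c, hc⟩) : ℂ) := by
    rw [unipotentCharFrom_apply, unipotentCharFrom_apply, ← hu', superdiagSumFrom_high_mul_low hc hc0 hh hy₀,
      AddChar.map_add_eq_mul, Circle.coe_mul]
  -- `Y_c(K)`-invariance of the integrand at `g`
  have hG : ∀ (γ : ↥(rationalColRange n K c c)) (y : ↥(adelicColRange n K c c)),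
      colIntegrand c hc hc0 Φ g (γ • y) = colIntegrand c hc hc0 Φ g y := by
    intro γ y
    set ι := algebraMap K (AdeleRing (𝓞 K) K) with hι
    obtain ⟨γ₀, hγ₀⟩ := (mem_rationalColRange_iff (γ : ↥(adelicColRange n K c c))).1 γ.2
    have hγA : Matrix.GeneralLinearGroup.map ι γ₀ ∈ adelicColRange n K c c := by
      rw [hγ₀]; exact (γ : ↥(adelicColRange n K c c)).2
    have hinj : Function.Injective ι := NumberField.AdeleRing.algebraMap_injective (𝓞 K) K
    have hγt : γ₀ ∈ tailUnipotent n K c :=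
      mem_tailUnipotent_of_map_mem hinj (unipotentColRange_le_tailUnipotent c c c hγA)
    have hγc : γ₀ ∈ cornerGL n K (c + 1) :=
      mem_cornerGL_of_map_mem hinj (unipotentColRange_le_cornerGL_succ c hγA)
    have hsmul : ((γ • y : ↥(adelicColRange n K c c)) : GL (Fin n) (AdeleRing (𝓞 K) K)) =
        Matrix.GeneralLinearGroup.map ι γ₀ * y := by
      rw [Subgroup.smul_def, smul_eq_mul, Subgroup.coe_mul, ← hγ₀]
    unfold colIntegrand
    rw [hsmul, mul_assoc, hΦK γ₀ hγt hγc]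
    congr 1
    have hγN : Matrix.GeneralLinearGroup.map ι γ₀ ∈ upperUnitriangular (Fin n) (AdeleRing (𝓞 K) K) := by
      rw [hγ₀]; exact adelicColRange_le_adelicUnipotent n K c c (γ : ↥(adelicColRange n K c c)).2
    have hyN : (y : GL (Fin n) (AdeleRing (𝓞 K) K)) ∈ upperUnitriangular (Fin n) (AdeleRing (𝓞 K) K) :=
      adelicColRange_le_adelicUnipotent n K c c y.2
    have h := unitriangular_mul_apply_pred hc hc0 hγN hyN
    rw [Units.val_mul] at h ⊢
    rw [h, AddChar.map_add_eq_mul]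
    have hγentry : ((Matrix.GeneralLinearGroup.map ι γ₀ : GL (Fin n) (AdeleRing (𝓞 K) K)) : Matrix (Fin n) (Fin n) (AdeleRing (𝓞 K) K))
        ⟨c - 1, by omega⟩ ⟨c, hc⟩ = ι ((γ₀ : Matrix (Fin n) (Fin n) K) ⟨c - 1, by omega⟩ ⟨c, hc⟩) := rfl
    rw [hγentry, hι, adeleAddChar_algebraMap, mul_one]
  -- the character value of `y₀`
  set χ₀ : ℂ := (adeleAddChar K ((y₀ : Matrix (Fin n) (Fin n) (AdeleRing (𝓞 K) K)) ⟨c - 1, by omega⟩ ⟨c, hc⟩) : ℂ)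
    with hχ₀
  have hχ₀1 : χ₀ * conj χ₀ = 1 := by
    rw [hχ₀, ← Circle.coe_inv_eq_conj, ← Circle.coe_mul, mul_inv_cancel, Circle.coe_one]
  -- pointwise identity for the integrand: `Φ(y u g) conj χ(y) = ψ_{≥c+1}(h) χ(y₀) · (Φ(y y₀ g) conj χ(y y₀))`
  have hpt : ∀ y : ↥(adelicColRange n K c c),
      colIntegrand c hc hc0 Φ (u * g) y =
        ((unipotentCharFrom (K := K) (c + 1) h : ℂ) * χ₀) * colIntegrand c hc hc0 Φ g (y * Y₀) := by
    intro y
    -- `y u = (y h y⁻¹) (y y₀)`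
    have hconj : (y : GL (Fin n) (AdeleRing (𝓞 K) K)) * h * (y : GL (Fin n) (AdeleRing (𝓞 K) K))⁻¹ ∈
        adelicColRange n K (c + 1) (n - 1) := conj_mem_colRangeHigh c hh y.2
    have e1 : (y : GL (Fin n) (AdeleRing (𝓞 K) K)) * (u * g) =
        ((y : GL (Fin n) (AdeleRing (𝓞 K) K)) * h * (y : GL (Fin n) (AdeleRing (𝓞 K) K))⁻¹) *
          (((y * Y₀ : ↥(adelicColRange n K c c)) : GL (Fin n) (AdeleRing (𝓞 K) K)) * g) := by
      rw [← hu']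
      change _ = _ * ((y : GL (Fin n) (AdeleRing (𝓞 K) K)) * y₀ * g)
      group
    -- the character of `y h y⁻¹` is that of `h`
    have e2 : unipotentCharFrom (K := K) (c + 1)
        ((y : GL (Fin n) (AdeleRing (𝓞 K) K)) * h * (y : GL (Fin n) (AdeleRing (𝓞 K) K))⁻¹) =
        unipotentCharFrom (K := K) (c + 1) h := by
      rw [unipotentCharFrom_apply, unipotentCharFrom_apply]
      congr 1
      have hyinv : ((y : GL (Fin n) (AdeleRing (𝓞 K) K)))⁻¹ ∈ adelicColRange n K c c :=
        (adelicColRange n K c c).inv_mem y.2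
      rw [mul_assoc, Units.val_mul, superdiagSumFrom_succ_colGroup_mul y.2,
        superdiagSumFrom_succ_high_mul_low hh hyinv]
    -- the entry `(c-1,c)` of `y y₀`
    have e3 : ((((y * Y₀ : ↥(adelicColRange n K c c)) : GL (Fin n) (AdeleRing (𝓞 K) K))) :
        Matrix (Fin n) (Fin n) (AdeleRing (𝓞 K) K)) ⟨c - 1, by omega⟩ ⟨c, hc⟩ =
        ((y₀ : Matrix (Fin n) (Fin n) (AdeleRing (𝓞 K) K)) ⟨c - 1, by omega⟩ ⟨c, hc⟩) +
          (((y : GL (Fin n) (AdeleRing (𝓞 K) K))) : Matrix (Fin n) (Fin n) (AdeleRing (𝓞 K) K))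
            ⟨c - 1, by omega⟩ ⟨c, hc⟩ := by
      change (((y : GL (Fin n) (AdeleRing (𝓞 K) K)) * y₀ : GL (Fin n) (AdeleRing (𝓞 K) K)) :
        Matrix (Fin n) (Fin n) (AdeleRing (𝓞 K) K)) _ _ = _
      exact unitriangular_mul_apply_pred hc hc0 (adelicColRange_le_adelicUnipotent n K c c y.2)
        (adelicColRange_le_adelicUnipotent n K c c hy₀)
    unfold colIntegrand
    rw [e1, hΦU _ hconj, e2, e3, AddChar.map_add_eq_mul, Circle.coe_mul, map_mul, ← hχ₀]
    set A : ℂ := (unipotentCharFrom (K := K) (c + 1) h : ℂ)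
    set B : ℂ := Φ ((((y * Y₀ : ↥(adelicColRange n K c c)) : GL (Fin n) (AdeleRing (𝓞 K) K))) * g)
    set cy : ℂ := conj ((adeleAddChar K ((((y : GL (Fin n) (AdeleRing (𝓞 K) K))) :
      Matrix (Fin n) (Fin n) (AdeleRing (𝓞 K) K)) ⟨c - 1, by omega⟩ ⟨c, hc⟩)) : ℂ)
    linear_combination (-(A * B * cy)) * hχ₀1
  -- assemble
  rw [colTransform_eq, colTransform_eq]
  simp_rw [hpt]
  rw [integral_const_mul, setIntegral_box_mul_right_eq hc Measure.haar hG Y₀, hchar]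
  simp only [Complex.real_smul]
  ring

/-- `U_{[0,b]} = U_{[1,b]}` (the column `0` has no entries above the diagonal). [folklore] -/
theorem unipotentColRange_zero_eq {R : Type*} [CommRing R] (b : ℕ) :
    unipotentColRange n R 0 b = unipotentColRange n R 1 b := by
  refine le_antisymm (fun u hu => ?_) (unipotentColRange_mono (Nat.zero_le 1) le_rfl)
  refine ⟨hu.1, fun i j hij hj => ?_⟩
  by_cases hj0 : (j : ℕ) = 0
  · have hji : j ≤ i := Fin.le_def.2 (by omega)
    exact (apply_of_le hu hji).trans (if_neg hij)
  · exact hu.2 i j hij fun h => hj ⟨by omega, h.2⟩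

omit [MeasurableSpace (GL (Fin n) (AdeleRing (𝓞 K) K))] [BorelSpace (GL (Fin n) (AdeleRing (𝓞 K) K))] in
/-- `ψ_{≥0} = ψ_{≥1}`. [folklore] -/
theorem unipotentCharFrom_zero (u : GL (Fin n) (AdeleRing (𝓞 K) K)) :
    unipotentCharFrom (K := K) 0 u = unipotentCharFrom (K := K) 1 u := by
  rw [unipotentCharFrom_apply, unipotentCharFrom_apply]
  congr 1
  unfold superdiagSumFrom
  refine Finset.sum_congr rfl fun j _ => ?_
  by_cases h : 0 < (j : ℕ)
  · rw [dif_pos ⟨Nat.zero_le _, h⟩, dif_pos ⟨h, h⟩]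
  · rw [dif_neg (fun h' => h h'.2), dif_neg (fun h' => h h'.2)]

omit [MeasurableSpace (GL (Fin n) (AdeleRing (𝓞 K) K))] [BorelSpace (GL (Fin n) (AdeleRing (𝓞 K) K))] in
/-- `ψ_{≥c}(1) = 1`… more generally `ψ_{≥n}(u) = 1` is not needed; we record `ψ_{≥c}` on the trivial
group: `ψ_{≥c}(1) = 1`. [folklore] -/
theorem unipotentCharFrom_one (c : ℕ) : unipotentCharFrom (K := K) (n := n) c 1 = 1 := by
  rw [unipotentCharFrom_apply]
  have : superdiagSumFrom c (((1 : GL (Fin n) (AdeleRing (𝓞 K) K)) : Matrix (Fin n) (Fin n) (AdeleRing (𝓞 K) K))) = 0 := by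
    unfold superdiagSumFrom
    refine Finset.sum_eq_zero fun j _ => ?_
    by_cases h : c ≤ (j : ℕ) ∧ 0 < (j : ℕ)
    · rw [dif_pos h, Units.val_one, Matrix.one_apply, if_neg]
      intro he
      have := congrArg Fin.val he
      simp at this
      omega
    · rw [dif_neg h]
  rw [this, AddChar.map_zero_eq_one]

/-- **`(U, ψ)`-equivariance of the partial Whittaker transforms.** For `φ` left `GL_n(K)`-invariant,
`whittakerIter k φ (u x) = ψ_{≥ n-k}(u) · whittakerIter k φ x` for all `u ∈ U_{[n-k, n-1]}(𝔸_K)`; for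
`k = n - 1` this is `W(u g) = ψ_N(u) W(g)` (Cogdell (2004), §1.1). Induction on `k` with
`colTransform_colRange_mul` and the `P`-invariance `whittakerIter_mul_left_of_mem`. [folklore] -/
theorem whittakerIter_colRange_mul {φ : GL (Fin n) (AdeleRing (𝓞 K) K) → ℂ}
    (hφK : ∀ (γ₀ : GL (Fin n) K) (x : GL (Fin n) (AdeleRing (𝓞 K) K)),
      φ (Matrix.GeneralLinearGroup.map (algebraMap K (AdeleRing (𝓞 K) K)) γ₀ * x) = φ x) :
    ∀ (k : ℕ) (u : GL (Fin n) (AdeleRing (𝓞 K) K)), u ∈ adelicColRange n K (n - k) (n - 1) →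
      ∀ x, whittakerIter k φ (u * x) = (unipotentCharFrom (K := K) (n - k) u : ℂ) * whittakerIter k φ x
  | 0 => by
    intro u hu x
    have hbot : adelicColRange n K (n - 0) (n - 1) = ⊥ :=
      unipotentColRange_eq_bot fun j h => by have := j.2; have h1 := h.1; simp at h1; omega
    rw [hbot, Subgroup.mem_bot] at hu
    subst hu
    rw [one_mul, unipotentCharFrom_one, Circle.coe_one, one_mul]
  | k + 1 => by
    intro u hu x
    by_cases h : n - (k + 1) < n ∧ 0 < n - (k + 1)
    · have e : whittakerIter (K := K) (k + 1) φ =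
          colTransform (n - (k + 1)) h.1 h.2 (whittakerIter k φ) := by
        funext g; simp only [whittakerIter, dif_pos h]
      rw [e]
      have e1 : n - k = n - (k + 1) + 1 := by omega
      have e2 : n - 1 - k = n - (k + 1) := by omega
      refine colTransform_colRange_mul _ h.1 h.2 ?_ ?_ hu x
      · intro q₀ hq hqc y
        refine whittakerIter_mul_left_of_mem hφK k q₀ ?_ ?_ y
        · rw [e2]; exact hq
        · rw [e1]; exact hqc
      · intro h' hh' y
        have := whittakerIter_colRange_mul hφK k h' (by rw [e1]; exact hh') y
        rw [e1] at this
        exact this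
    · have e : whittakerIter (K := K) (k + 1) φ = whittakerIter k φ := by
        funext g; simp only [whittakerIter, dif_neg h]
      rw [e]
      by_cases hk : n - (k + 1) = n - k
      · rw [hk] at hu ⊢
        exact whittakerIter_colRange_mul hφK k u hu x
      · -- then `n - (k+1) = 0` and `n - k = 1`
        have h0 : n - (k + 1) = 0 := by omega
        have h1 : n - k = 1 := by omega
        rw [h0] at hu ⊢
        rw [show adelicColRange n K 0 (n - 1) = adelicColRange n K 1 (n - 1) from
          unipotentColRange_zero_eq (n - 1)] at hu
        rw [unipotentCharFrom_zero]
        have := whittakerIter_colRange_mul hφK k u (by rw [h1]; exact hu) x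
        rw [h1] at this
        exact this

/-- The same for `Φ_d = whittakerDepth d φ` (`d < n`): `Φ_d(u x) = ψ_{≥ d+1}(u) Φ_d(x)` for
`u ∈ U_{[d+1, n-1]}(𝔸_K)`. [folklore] -/
theorem whittakerDepth_colRange_mul {φ : GL (Fin n) (AdeleRing (𝓞 K) K) → ℂ}
    (hφK : ∀ (γ₀ : GL (Fin n) K) (x : GL (Fin n) (AdeleRing (𝓞 K) K)),
      φ (Matrix.GeneralLinearGroup.map (algebraMap K (AdeleRing (𝓞 K) K)) γ₀ * x) = φ x)
    {d : ℕ} (hd : d < n) {u : GL (Fin n) (AdeleRing (𝓞 K) K)} (hu : u ∈ adelicColRange n K (d + 1) (n - 1))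
    (x : GL (Fin n) (AdeleRing (𝓞 K) K)) :
    whittakerDepth d φ (u * x) = (unipotentCharFrom (K := K) (d + 1) u : ℂ) * whittakerDepth d φ x := by
  unfold whittakerDepth
  have e : n - (n - 1 - d) = d + 1 := by omega
  have h := whittakerIter_colRange_mul hφK (n - 1 - d) u (by rw [e]; exact hu) x
  rw [e] at h
  exact h

/-- In particular **`|Φ_d|` is left-invariant under `U_{[d+1,n-1]}(𝔸_K)`**. [folklore] -/
theorem norm_whittakerDepth_colRange_mul {φ : GL (Fin n) (AdeleRing (𝓞 K) K) → ℂ}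
    (hφK : ∀ (γ₀ : GL (Fin n) K) (x : GL (Fin n) (AdeleRing (𝓞 K) K)),
      φ (Matrix.GeneralLinearGroup.map (algebraMap K (AdeleRing (𝓞 K) K)) γ₀ * x) = φ x)
    {d : ℕ} (hd : d < n) {u : GL (Fin n) (AdeleRing (𝓞 K) K)} (hu : u ∈ adelicColRange n K (d + 1) (n - 1))
    (x : GL (Fin n) (AdeleRing (𝓞 K) K)) :
    ‖whittakerDepth d φ (u * x)‖ = ‖whittakerDepth d φ x‖ := by
  rw [whittakerDepth_colRange_mul hφK hd hu, norm_mul, Circle.norm_coe, one_mul]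

end Equivariance

/-! ### The Fourier coefficients of `y ↦ Φ_d(y g)` along `Y_d` are values of `Φ_{d-1}` -/

section Coefficients

variable {n : ℕ} {K : Type} [Field K] [NumberField K]
variable [MeasurableSpace (GL (Fin n) (AdeleRing (𝓞 K) K))] [BorelSpace (GL (Fin n) (AdeleRing (𝓞 K) K))]

omit [MeasurableSpace (GL (Fin n) (AdeleRing (𝓞 K) K))] [BorelSpace (GL (Fin n) (AdeleRing (𝓞 K) K))] in
/-- **Conjugating by a corner moves the low row into the character**: for `s ∈ GL_d` (corner) and any
matrix `M`, `(s M s⁻¹)_{d-1,d} = Σ_{a < d} s_{d-1,a} M_{a,d}` (the column `d` of `s⁻¹` is `e_d`, the row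
`d-1` of `s` vanishes from the column `d` on). [folklore] -/
theorem corner_conj_apply_pred {R : Type*} [CommRing R] {d : ℕ} (hd : d < n) (hd0 : 0 < d)
    {s : GL (Fin n) R} (hs : s ∈ cornerGL n R d) (M : Matrix (Fin n) (Fin n) R) :
    ((s : Matrix (Fin n) (Fin n) R) * M * ((s⁻¹ : GL (Fin n) R) : Matrix (Fin n) (Fin n) R)) ⟨d - 1, by omega⟩ ⟨d, hd⟩ =
      ∑ a : ColIdx n d, (s : Matrix (Fin n) (Fin n) R) ⟨d - 1, by omega⟩ a.1 * M a.1 ⟨d, hd⟩ := by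
  classical
  have hsinv : s⁻¹ ∈ cornerGL n R d := (cornerGL n R d).inv_mem hs
  rw [Matrix.mul_apply]
  have hcol : ∀ b : Fin n, ((s⁻¹ : GL (Fin n) R) : Matrix (Fin n) (Fin n) R) b ⟨d, hd⟩ =
      if b = ⟨d, hd⟩ then 1 else 0 := fun b => hsinv b _ (Or.inr (by simp))
  simp only [hcol, mul_ite, mul_one, mul_zero, Finset.sum_ite_eq', Finset.mem_univ, if_true]
  rw [Matrix.mul_apply]
  -- restrict the sum to `a < d`
  have hzero : ∀ a : Fin n, ¬ ((a : ℕ) < d) →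
      (s : Matrix (Fin n) (Fin n) R) ⟨d - 1, by omega⟩ a * M a ⟨d, hd⟩ = 0 := by
    intro a ha
    rw [hs _ a (Or.inr (not_lt.1 ha)), if_neg (fun h => by have := congrArg Fin.val h; simp at this; omega),
      zero_mul]
  rw [← Finset.sum_subset (Finset.subset_univ (Finset.univ.filter fun a : Fin n => (a : ℕ) < d))
    (fun a _ ha => hzero a (by simpa using ha))]
  rw [Finset.sum_subtype (Finset.univ.filter fun a : Fin n => (a : ℕ) < d)
    (p := fun a : Fin n => (a : ℕ) < d) (fun a => by simp)
    (fun a : Fin n => (s : Matrix (Fin n) (Fin n) R) ⟨d - 1, by omega⟩ a * M a ⟨d, hd⟩)]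

/-- **The Fourier coefficients along `Y_d` of `y ↦ Φ_d(y g)` are values of `Φ_{d-1}`.** Let `φ` be left
`GL_n(K)`-invariant, `1 ≤ d < n`, `η : ColIdx n d → K`, and `B ∈ GL_d(K)` with low row `η`
(`exists_lowRow_lowCornerGL_eq` provides one when `η ≠ 0`); put `s = diag(B, 1) ∈ GL_n(K)`. Then

  `Φ_{d-1}(s g) = μ(box)⁻¹ ∫_{box} conj ψ_η(y) Φ_d(y g) dμ(y)`

(`μ` the Haar measure `Measure.haar` of `Y_d(𝔸_K)`, `box` its Tate box, `ψ_η = colChar d η`): in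
`Φ_{d-1}(s g) = T_d Φ_d (s g)` move `s` through the integral (`setIntegral_box_mul_normalizer_eq`):
`Φ_d` is left `s`-invariant, and `ψ(y_{d-1,d}) = ψ_η(s⁻¹ y s)` by `corner_conj_apply_pred` and
`lowRow_lowCornerGL`. This is the identity `c_η(g) = W'(γ_η g)` of the Fourier–Whittaker recursion
(Cogdell (2004), proof of Thm. 1.1). [folklore] -/
theorem whittakerDepth_pred_lowCorner_mul {φ : GL (Fin n) (AdeleRing (𝓞 K) K) → ℂ}
    (hφK : ∀ (γ₀ : GL (Fin n) K) (x : GL (Fin n) (AdeleRing (𝓞 K) K)),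
      φ (Matrix.GeneralLinearGroup.map (algebraMap K (AdeleRing (𝓞 K) K)) γ₀ * x) = φ x)
    {d : ℕ} (hd : d < n) (hd0 : 0 < d) (η : ColIdx n d → K) (B : GL (ColIdx n d) K)
    (hB : lowRow d (lowCornerGL (n := n) (R := K) d B) = η) (g : GL (Fin n) (AdeleRing (𝓞 K) K)) :
    whittakerDepth (d - 1) φ
        (Matrix.GeneralLinearGroup.map (algebraMap K (AdeleRing (𝓞 K) K)) (lowCornerGL (n := n) (R := K) d B) * g) =
      ((Measure.haar (G := ↥(adelicColRange n K d d))) (colRangeTateDomain n K d d)).toReal⁻¹ •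
        ∫ y in colRangeTateDomain n K d d,
          conj (colChar (n := n) (K := K) d hd η y : ℂ) * whittakerDepth d φ ((y : GL (Fin n) (AdeleRing (𝓞 K) K)) * g)
          ∂(Measure.haar (G := ↥(adelicColRange n K d d))) := by
  set ι := algebraMap K (AdeleRing (𝓞 K) K) with hι
  set s₀ := lowCornerGL (n := n) (R := K) d B with hs₀
  set Φ := whittakerDepth d φ with hΦ
  rw [whittakerDepth_pred hd0 hd φ, colTransform_eq]
  congr 1
  -- hypotheses of the normaliser lemma
  have hs₀c : s₀ ∈ cornerGL n K d := lowCornerGL_mem_cornerGL d B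
  have hsinvc : Matrix.GeneralLinearGroup.map ι s₀⁻¹ ∈ cornerGL n (AdeleRing (𝓞 K) K) d :=
    map_mem_cornerGL ι ((cornerGL n K d).inv_mem hs₀c)
  have hθ : ∀ u : GL (Fin n) (AdeleRing (𝓞 K) K), u ∈ adelicColRange n K d d ↔
      Matrix.GeneralLinearGroup.map ι s₀⁻¹ * u * (Matrix.GeneralLinearGroup.map ι s₀⁻¹)⁻¹ ∈ adelicColRange n K d d := by
    intro u
    constructor
    · intro hu; exact conj_mem_unipotentColRange_of_mem_cornerGL hsinvc hu
    · intro hu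
      have h := conj_mem_unipotentColRange_of_mem_cornerGL ((cornerGL n _ d).inv_mem hsinvc) hu
      simpa [mul_assoc] using h
  have hfs : ∀ x, Φ (Matrix.GeneralLinearGroup.map ι s₀ * x) = Φ x := fun x =>
    whittakerDepth_mul_left_of_mem hφK hd (cornerGL_le_tailUnipotent d hs₀c) (cornerGL_mono (by omega) hs₀c) x
  have hmain := setIntegral_box_mul_normalizer_eq (Measure.haar) s₀ hθ hfs
    (χ := fun y => conj (adeleAddChar K (((y : GL (Fin n) (AdeleRing (𝓞 K) K)) : Matrix (Fin n) (Fin n) (AdeleRing (𝓞 K) K))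
      ⟨d - 1, by omega⟩ ⟨d, hd⟩) : ℂ))
    (χ' := fun y => conj (colChar (n := n) (K := K) d hd η y : ℂ)) ?_ g ?_
  · -- rearrange the integrands
    have e : ∀ y : ↥(adelicColRange n K d d), colIntegrand d hd hd0 Φ
        (Matrix.GeneralLinearGroup.map ι s₀ * g) y =
        Φ ((y : GL (Fin n) (AdeleRing (𝓞 K) K)) * Matrix.GeneralLinearGroup.map ι s₀ * g) *
          conj (adeleAddChar K (((y : GL (Fin n) (AdeleRing (𝓞 K) K)) : Matrix (Fin n) (Fin n) (AdeleRing (𝓞 K) K))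
            ⟨d - 1, by omega⟩ ⟨d, hd⟩) : ℂ) := fun y => by
      unfold colIntegrand; rw [mul_assoc]
    beta_reduce at hmain
    rw [(setIntegral_congr_fun measurableSet_colRangeTateDomain (fun y _ => e y)).trans hmain]
    exact setIntegral_congr_fun measurableSet_colRangeTateDomain fun y _ => mul_comm _ _
  · -- character compatibility: `ψ(y_{d-1,d}) = ψ_η(s⁻¹ y s)`
    intro y
    have e3 : (Matrix.GeneralLinearGroup.map ι s₀⁻¹)⁻¹ = Matrix.GeneralLinearGroup.map ι s₀ := by
      rw [map_inv, inv_inv]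
    -- compute `y_{d-1,d}` as `(s (s⁻¹ y s) s⁻¹)_{d-1,d}`
    set y' : ↥(adelicColRange n K d d) := colRangeConj _ hθ y with hy'
    have hy : ((y : GL (Fin n) (AdeleRing (𝓞 K) K)) : Matrix (Fin n) (Fin n) (AdeleRing (𝓞 K) K)) =
        ((Matrix.GeneralLinearGroup.map ι s₀ : GL (Fin n) (AdeleRing (𝓞 K) K)) : Matrix (Fin n) (Fin n) (AdeleRing (𝓞 K) K)) *
          (((y' : ↥(adelicColRange n K d d)) : GL (Fin n) (AdeleRing (𝓞 K) K)) : Matrix (Fin n) (Fin n) (AdeleRing (𝓞 K) K)) *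
          (((Matrix.GeneralLinearGroup.map ι s₀)⁻¹ : GL (Fin n) (AdeleRing (𝓞 K) K)) : Matrix (Fin n) (Fin n) (AdeleRing (𝓞 K) K)) := by
      rw [hy', coe_colRangeConj_apply, e3, ← Units.val_mul, ← Units.val_mul]
      congr 1
      rw [map_inv]
      group
    congr 2
    rw [hy, corner_conj_apply_pred hd hd0 (map_mem_cornerGL ι hs₀c)]
    unfold colChar
    congr 1
    refine Finset.sum_congr rfl fun a _ => ?_
    congr 1
    -- `s_{d-1,a} = η_a`
    have h2 := congrFun hB a
    change ι ((s₀ : Matrix (Fin n) (Fin n) K) ⟨d - 1, by omega⟩ a.1) = ι (η a)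
    congr 1
    rw [← h2]
    unfold lowRow
    rw [dif_pos ⟨hd0, by omega⟩]
  · -- `Y_d(K)`-invariance of `y ↦ Φ(y g) conj ψ_η(y)`
    intro γ y
    obtain ⟨γ₀, hγ₀⟩ := (mem_rationalColRange_iff (γ : ↥(adelicColRange n K d d))).1 γ.2
    have hγA : Matrix.GeneralLinearGroup.map ι γ₀ ∈ adelicColRange n K d d := by
      rw [hγ₀]; exact (γ : ↥(adelicColRange n K d d)).2
    have hinj : Function.Injective ι := NumberField.AdeleRing.algebraMap_injective (𝓞 K) K
    have hγt : γ₀ ∈ tailUnipotent n K d :=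
      mem_tailUnipotent_of_map_mem hinj (unipotentColRange_le_tailUnipotent d d d hγA)
    have hγc : γ₀ ∈ cornerGL n K (d + 1) :=
      mem_cornerGL_of_map_mem hinj (unipotentColRange_le_cornerGL_succ d hγA)
    have hsmul : ((γ • y : ↥(adelicColRange n K d d)) : GL (Fin n) (AdeleRing (𝓞 K) K)) =
        Matrix.GeneralLinearGroup.map ι γ₀ * y := by
      rw [Subgroup.smul_def, smul_eq_mul, Subgroup.coe_mul, ← hγ₀]
    have hΦK' : ∀ x, Φ (Matrix.GeneralLinearGroup.map ι γ₀ * x) = Φ x := fun x =>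
      whittakerDepth_mul_left_of_mem hφK hd hγt hγc x
    rw [hsmul, mul_assoc, hΦK']
    congr 2
    rw [Subgroup.smul_def, smul_eq_mul, colChar_mul, colChar_eq_one_of_mem_rational d hd η γ.2, one_mul]

end Coefficients

end Literature.NumberTheory.Automorphic
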